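import Literature.NumberTheory.LFunctions.ConreyIwaniec2002MollifierMeanSquare
import HarnessLib

/-!
# Conrey–Iwaniec (2002), §6/§9: `#{𝔞 : N𝔞 = n} = τ(n,χ)` for the imaginary quadratic field

Conrey–Iwaniec, *Spacing of zeros of Hecke L-functions and the class number problem*, Acta Arith.
103 (2002), §6 (6.42)–(6.43) and §9 (9.4) [held text `paper:arxiv-math_0111012`, p0016, p0020]:
for `K = ℚ(√−q)` with `χ = (−q/·)` the odd primitive quadratic character mod `q`,
`ζ_K(s) = ζ(s)L(s,χ)` (6.42), so the number of integral ideals of norm `n` is the coefficient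
`τ(n,χ) = Σ_{d∣n} χ(d)` (6.43); this is the source of "`|λ(n)|, |λ*(n)| ≤ τ(n,χ)`" (9.4) in the
proof of Proposition 9.1.

PROVED HERE (no named fact): the EQUALITY forms
`ConreyIwaniec2002.idealNormCount_eq_divisorSumChar_of_quadratic` (`(#{𝔞 : N𝔞 = n} : ℂ) = Σ_{d∣n}χ(d)`)
and `ConreyIwaniec2002.idealNormCount_eq_norm_divisorSumChar_of_quadratic`
(`#{𝔞 : N𝔞 = n} = |Σ_{d∣n}χ(d)|`, the registered signature of stub S5
`stub_idealNormCount_eq_norm_divisorSumChar` of the I6b skeleton `prop81-moebius-perron`, verbatim),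
by the same `L`-series injectivity argument as the tree's inequality form
`ConreyIwaniec2002.idealNormCount_le_card_divisors_of_quadratic` (which is re-derived from them).

## References

* [ConreyIwaniec2002] B. Conrey, H. Iwaniec, Acta Arith. 103 (2002) 259–312, arXiv:math/0111012:
  §6 (6.42)–(6.43); §9 (9.4).
-/

noncomputable section

open scoped NumberField LSeries.notation
open Complex

namespace Literature.NumberTheory.LFunctions

namespace ConreyIwaniec2002

open NumberField

/-- **`#{𝔞 ⊂ 𝓞_K : N𝔞 = n} = τ(n,χ) = Σ_{d∣n} χ(d)` for the imaginary quadratic field of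
discriminant `−q`** (`K = ℚ(√−q)`, `χ = (−q/·)` odd, primitive, quadratic mod `q`; `n ≠ 0`): the
coefficients of `ζ_K(s) = ζ(s)L(s,χ)` ((6.42)–(6.43)), identified by the injectivity of `L`-series
(as complex numbers). [cite: ConreyIwaniec2002, §6 (6.42)–(6.43)] -/
theorem idealNormCount_eq_divisorSumChar_of_quadratic {q : ℕ} [NeZero q]
    {χ : DirichletCharacter ℂ q} (hprim : χ.IsPrimitive) (hquad : χ.IsQuadratic) (hodd : χ.Odd)
    (K : Type*) [Field K] [NumberField K] (h2 : Module.finrank ℚ K = 2)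
    (hdisc : NumberField.discr K = -(q : ℤ)) {n : ℕ} (hn : n ≠ 0) :
    (idealNormCount K n : ℂ) = divisorSumChar χ n := by
  -- the two coefficient sequences
  set f : ℕ → ℂ := fun n => (idealNormCount K n : ℂ) with hf
  set g : ℕ → ℂ := (1 : ℕ → ℂ) ⍟ (fun n => χ n) with hg
  -- both `L`-series converge somewhere
  have hfabs : LSeries.abscissaOfAbsConv f < ⊤ :=
    lt_of_le_of_lt (abscissaOfAbsConv_idealNormCount_le K) (by exact_mod_cast EReal.coe_lt_top 1)
  have h2re : (1 : ℝ) < (2 : ℂ).re := by norm_num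
  have hgsum : LSeriesSummable g 2 :=
    (LSeriesSummable_one_iff.mpr h2re).convolution
      (DirichletCharacter.LSeriesSummable_of_one_lt_re χ h2re)
  have hgabs : LSeries.abscissaOfAbsConv g < ⊤ :=
    lt_of_le_of_lt hgsum.abscissaOfAbsConv_le (EReal.coe_lt_top _)
  -- they agree for real `x > 1`: `ζ_K = ζ · L(·,χ)`
  have heq : (fun x : ℝ => LSeries f x) =ᶠ[Filter.atTop] fun x => LSeries g x := by
    filter_upwards [Filter.eventually_gt_atTop 1] with x hx
    have hx' : 1 < (x : ℂ).re := by simpa using hx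
    have h1 := Literature.NumberTheory.QuadraticFields.Quadratic.dedekindZeta_eq_riemannZeta_mul_LFunction_of_odd_primitive
      (K := K) hprim hquad hodd h2 hdisc hx'
    rw [dedekindZeta_eq_LSeries] at h1
    rw [hf, h1, hg, LSeries_convolution' (LSeriesSummable_one_iff.mpr hx')
      (DirichletCharacter.LSeriesSummable_of_one_lt_re χ hx'), LSeries_one_eq_riemannZeta hx',
      DirichletCharacter.LFunction_eq_LSeries χ hx']
  have hcoef : f n = g n := LSeries.eq_of_LSeries_eventually_eq hfabs hgabs heq hn
  -- `g n = Σ_{d ∣ n} χ(d)`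
  have hgn : g n = divisorSumChar χ n := by
    rw [hg, LSeries.convolution_def, divisorSumChar_apply]
    beta_reduce
    rw [Nat.sum_divisorsAntidiagonal' (f := fun a b => (1 : ℕ → ℂ) a * χ b)]
    simp
  have hfn : f n = (idealNormCount K n : ℂ) := by rw [hf]
  rw [← hfn, hcoef, hgn]

/-- **`#{𝔞 ⊂ 𝓞_K : N𝔞 = n} = |τ(n,χ)| = |Σ_{d∣n} χ(d)|` for `K = ℚ(√−q)`** (real form; the
registered signature of stub S5 `stub_idealNormCount_eq_norm_divisorSumChar` of the I6b skeleton
`prop81-moebius-perron`, verbatim): the equality form of the tree's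
`idealNormCount_le_card_divisors_of_quadratic`. [cite: ConreyIwaniec2002, §6 (6.42)–(6.43); §9 (9.4)] -/
theorem idealNormCount_eq_norm_divisorSumChar_of_quadratic {q : ℕ} [NeZero q]
    {χ : DirichletCharacter ℂ q} (hprim : χ.IsPrimitive) (hquad : χ.IsQuadratic) (hodd : χ.Odd)
    (K : Type) [Field K] [NumberField K] (h2 : Module.finrank ℚ K = 2)
    (hdisc : NumberField.discr K = -(q : ℤ)) {n : ℕ} (hn : n ≠ 0) :
    (idealNormCount K n : ℝ) = ‖divisorSumChar χ n‖ := by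
  rw [← idealNormCount_eq_divisorSumChar_of_quadratic hprim hquad hodd K h2 hdisc hn]
  simp

end ConreyIwaniec2002

end Literature.NumberTheory.LFunctions

end
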